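import Literature.NumberTheory.GaloisRepresentations.IdeleTruncatedSLocalization
import Literature.Algebra.Homology.DiscreteRepPermutationLocalization
import Literature.Algebra.Homology.DiscreteRepPermutationPresentation
import Literature.Algebra.Homology.DiscreteRepCoindPullbackShapiro
import HarnessLib

/-!
# Injectivity of `Ext²_{G_S}(A, Ī_S) → ∏_{w ∣ S ∪ ∞} Ext²_{Γ_{K_w}}(A, K̄_wˣ)` for a finite `G_S`-module `A`
# from the permutation-level arithmetic inputs (Milne ADT I Lemma 4.13 at `r = 2`, injectivity half;
# Harari Prop. 17.25) — the assembly of the PERMUTATION DÉVISSAGE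

Topic `NumberTheory/GaloisRepresentations`; namespace `Literature.NumberTheory.GaloisRepresentations.IdeleReadout`.
Definitions with bodies (`IsOverS`, `OverS`, the local family `locFun` / `locQ`, `idLocMap`) and theorems;
NO named fact, no `sorry`, no instance, no notation; number fields in `Type`.

THE STATEMENT.  `K` a number field, `S` a finite set of finite places, `G_S = Γ_K ⧸ N_S`, `Ī_S =
truncIdeleBarD K S` (Harari's `I_S`, -w6 g10), and for a place `w` of `K` over `S ∪ ∞` the decomposition
map `φ_w : Γ_{K_w} → G_S`, the discrete module `K̄_wˣ` and the idèle projection `pr_w : φ_w^* Ī_S ⟶ K̄_wˣ`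
(`IdeleTruncatedSLocalization`).  THE LOCALISATION MAP of the lane is
`idLocMap K S A n := ExtLocalization.locMap (fun w => Res_{φ_w}) (fun w => pr_w) A n :
Extⁿ_{C_{G_S}}(A, Ī_S) →+ ∏_{w ∣ S ∪ ∞} Extⁿ_{C_{Γ_{K_w}}}(φ_w^* A, K̄_wˣ)`.  Main theorem
**`idLocMap_injective_two_of_inputs`**: for `A` finite and `U ≤ G_S` open normal (finite index) acting
trivially on `A`, `idLocMap K S A 2` is INJECTIVE provided the five permutation-level inputs hold, in their
RAW cohomological shapes:
* [P1-mono] `Ext¹_{C_U}(ℤ, Res_U Ī_S) = 0` (`H¹(U, Ī_S) = 0`: Hilbert 90 on the layers — bsd-eis -w3 g18, E3);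
* [P1-epi-local] `Ext¹_{C_V}(ℤ, Res_V K̄_wˣ) = 0` for `V = φ_w⁻¹(U)` (Hilbert 90 — -w3 g18, E3);
* [P2-mono] a class `y ∈ Ext²_{C_U}(ℤ, Res_U Ī_S)` all of whose CONJUGATED local pull-backs
  `Res_{ψ_{w,t}}(y) ∘ [pr_w ∘ ρ(s_t⁻¹)]` vanish (`t` over the double cosets `U\G_S/φ_w(Γ_{K_w})` = places of
  `K_S^U` above `w`) is zero (`H²(U, Ī_S) ↪ ∏ Br`: -w3 g18, E3);
* [P0-epi] / [Hom-mono] in degree `0` (idèle components incl. the archimedean ones — open, E3c);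
— by `DiscreteRep.locMap_injective_two_of_permutation` (E4a §5: two-step presentation by `Coind_U(ℤ^m)` +
the four-lemma dévissage E1), the `ℤ^m ⇝ ℤ` reductions of E4b (`locMap_injective/surjective_coindD_fin`,
`ext_triv_pi_pi_eq_zero`), Shapiro for `Coind_U ⊣ Res_U` (door-c4 `extAdjunctionMap_bijective`,
`extCoindResAddEquiv`), the Mackey isomorphism (E2a `coindPullbackIso`) and the component formula (E2b
`locComponent_eq`).

HONEST FRAMING: a reduction with displayed hypotheses (the arithmetic inputs are quoted, not proved here;
their providers are named above).  Composed with the divisible comparison `Ext²_{C_{Γ_{K_v}}}(φ_v^* A, K̄_vˣ)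
≅ H²(K_v, Hom(A, K̄ˣ))` (-w7 g13, (Λ1) files) it yields hypothesis (Λ2) of
`PoitouTateRestrictedShaTwoLocalCriterion`; that composition is NOT in this file.  No case of Poitou–Tate
duality and nothing about BSD is proved here.  Lane «PT-Ш-S-TC» of crux `stmt-BirchSwinnertonDyer-19032`
(cell bsd-eis, seat bsd-line-x1-p1-w4 gen 20), file E4c of `LAMBDA-E-DEVISSAGE-w4g20.md`.  AI formalisation,
established only by the kernel check.

## References
* J. S. Milne, *Arithmetic Duality Theorems*, 2nd ed. (2006), I Lemma 4.13, I Thm. 4.10 (a) (proof, p. 58).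
  [MilneADT2006]
* D. Harari, *Galois Cohomology and Class Field Theory*, Universitext (2020), §17.5 Lemma 17.23, Prop. 17.25,
  Prop. 17.26. [Harari2020]
-/

noncomputable section

open NumberField IsDedekindDomain Field CategoryTheory CategoryTheory.Abelian
open Literature.Algebra.Homology Literature.Algebra.Homology.DiscreteRep
open scoped Classical

namespace Literature.NumberTheory.GaloisRepresentations

namespace IdeleReadout

open IdeleClassBar

variable (K : Type) [Field K] [NumberField K] (S : Finset (HeightOneSpectrum (𝓞 K)))

/-! ## §1 The index set `{w ∣ S ∪ ∞}` and the local family -/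

/-- A place lies over `S ∪ ∞`: every infinite place, and the finite places in `S`.
[cite: Harari2020, §17.5 Prop. 17.25][cite: MilneADT2006, I Lemma 4.13] -/
def IsOverS : Place K → Prop
  | Sum.inl _ => True
  | Sum.inr v => v ∈ S

/-- The index type of the local family: the places of `K` over `S ∪ ∞`. [cite: Harari2020, §17.5 Prop. 17.25] -/
abbrev OverS : Type := {w : Place K // IsOverS K S w}

/-- The local functor at `w`: pull-back along the decomposition map `φ_w : Γ_{K_w} → G_S`.
[cite: Harari2020, §17.5 Lemma 17.23] -/
abbrev locFun (w : OverS K S) :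
    DiscreteRepCat ℤ (GaloisGroupUnramifiedOutside K (↑S : Set (HeightOneSpectrum (𝓞 K)))) ⥤
      DiscreteRepCat ℤ (absoluteGaloisGroup (Place.Completion w.1)) :=
  resDHom ℤ (decompMapPlaceS K S w.1) (continuous_decompMapPlaceS K S w.1)

/-- The local coefficient map at `w`: the idèle projection `pr_w : φ_w^* Ī_S ⟶ K̄_wˣ`.
[cite: Harari2020, §17.5 Prop. 17.25] -/
abbrev locQ (w : OverS K S) : (locFun K S w).obj (truncIdeleBarD K S) ⟶ unitsD (Place.Completion w.1) :=
  idelePiPlaceSD K S w.1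

/-- **The localisation map `Extⁿ_{G_S}(A, Ī_S) →+ ∏_{w ∣ S ∪ ∞} Extⁿ_{Γ_{K_w}}(φ_w^* A, K̄_wˣ)`** of the
`S`-restricted `Ш`-pairing on the `Ext` road. [cite: MilneADT2006, I Lemma 4.13][cite: Harari2020, §17.5 Prop. 17.25] -/
abbrev idLocMap (A : DiscreteRepCat ℤ (GaloisGroupUnramifiedOutside K (↑S : Set (HeightOneSpectrum (𝓞 K)))))
    (n : ℕ) :=
  ExtLocalization.locMap (locFun K S) (locQ K S) (B := truncIdeleBarD K S) A n

/-! ## §2 Two local lemmas -/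

section Local

variable {K S}
variable (U : Subgroup (GaloisGroupUnramifiedOutside K (↑S : Set (HeightOneSpectrum (𝓞 K))))) [hUn : U.Normal]
  (hU : IsOpen (U : Set (GaloisGroupUnramifiedOutside K (↑S : Set (HeightOneSpectrum (𝓞 K)))))) [U.FiniteIndex]

/-- **Local `Ext¹` vanishing on a pulled-back permutation module**: if `Ext¹_{C_V}(ℤ, Res_V K̄_wˣ) = 0` for
`V = φ_w⁻¹(U)` then `Ext¹_{C_{Γ_{K_w}}}(φ_w^* Coind_U(ℤ^m), K̄_wˣ) = 0` — Mackey (`φ_w^* Coind_U(ℤ^m) ≅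
Coind_V(ℤ^{T × m})`), Shapiro and additivity. [cite: Harari2020, §17.5 Lemma 17.23, Prop. 17.26 (proof)] -/
theorem ext_one_locFun_coindD_eq_zero (w : OverS K S) [hVf : (U.comap (decompMapPlaceS K S w.1)).FiniteIndex]
    (P1epi : ∀ z : Ext (triv (k := ℤ) (Γ := ↥(U.comap (decompMapPlaceS K S w.1))) ℤ)
      ((resD ℤ (U.comap (decompMapPlaceS K S w.1))).obj (unitsD (Place.Completion w.1))) 1, z = 0)
    (m : ℕ) (z : Ext ((locFun K S w).obj ((coindD ℤ U hU).obj (triv (k := ℤ) (Γ := ↥U) (Fin m → ℤ))))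
      (unitsD (Place.Completion w.1)) 1) : z = 0 := by
  haveI := finite_doubleCosets (decompMapPlaceS K S w.1) U
  refine ext_eq_zero_of_iso_left (unitsD (Place.Completion w.1)) 1
    (coindPullbackIso (decompMapPlaceS K S w.1) (continuous_decompMapPlaceS K S w.1) U hU (Fin m → ℤ)
      (k := ℤ)).symm (fun z' => ?_) z
  -- Shapiro for `Coind_V ⊣ Res_V` and additivity over `T × m`
  apply (extCoindResAddEquiv (U.comap (decompMapPlaceS K S w.1))
    (isOpen_comap (decompMapPlaceS K S w.1) U (continuous_decompMapPlaceS K S w.1) hU) _ _ 1).injective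
  rw [map_zero]
  exact ext_triv_pi_pi_eq_zero _ 1 P1epi _ _ _

/-- **Vanishing of the `t`-th local component from the vanishing of the localisation**: if the `w`-component of
the localisation of `x ∈ Extⁿ(Coind_U(W), Ī_S)` is zero then so is every `locComponent … t x`.
[cite: Harari2020, §17.5 Lemma 17.23] -/
theorem locComponent_eq_zero_of_eq_zero (w : OverS K S) [hVf : (U.comap (decompMapPlaceS K S w.1)).FiniteIndex]
    (W : Type) [AddCommGroup W] [Module ℤ W] (n : ℕ)
    (x : Ext ((coindD ℤ U hU).obj (triv (k := ℤ) (Γ := ↥U) W)) (truncIdeleBarD K S) n)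
    (hx : (x.mapExactFunctor (locFun K S w)).comp (Ext.mk₀ (locQ K S w)) (add_zero n) = 0)
    (t : DoubleCosets (decompMapPlaceS K S w.1) U) :
    locComponent (decompMapPlaceS K S w.1) (continuous_decompMapPlaceS K S w.1) U hU W (truncIdeleBarD K S)
      (unitsD (Place.Completion w.1)) (locQ K S w) n t x = 0 := by
  unfold locComponent
  rw [hx, Ext.comp_zero, map_zero, Ext.comp_zero]

end Local

/-! ## §3 The main theorem -/

/-- **Injectivity of `Ext²_{G_S}(A, Ī_S) → ∏_{w ∣ S ∪ ∞} Ext²_{Γ_{K_w}}(φ_w^* A, K̄_wˣ)` for finite `A`, from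
the permutation-level inputs** (Milne I Lemma 4.13 at `r = 2`, injectivity half, reorganised as a dévissage:
the arithmetic enters only through `Hom/H¹/H²` of the open subgroup `U` with values in `Ī_S` and local
`H¹`'s).  Hypotheses: [P1-mono] `H¹(U, Ī_S) = 0`; [P1-epi-local] `H¹(φ_w⁻¹U, K̄_wˣ) = 0`; [P2-mono] injectivity
of the conjugated local pull-backs on `H²(U, Ī_S)` (one double-coset representative per place of `K_S^U`);
[P0-epi] and [Hom-mono] in degree `0`. [cite: MilneADT2006, I Lemma 4.13, I Thm. 4.10 (a) (proof, p. 58)]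
[cite: Harari2020, §17.5 Lemma 17.23, Prop. 17.25] -/
theorem idLocMap_injective_two_of_inputs
    (A : DiscreteRepCat ℤ (GaloisGroupUnramifiedOutside K (↑S : Set (HeightOneSpectrum (𝓞 K))))) [Finite A.obj.V]
    (U : Subgroup (GaloisGroupUnramifiedOutside K (↑S : Set (HeightOneSpectrum (𝓞 K))))) [hUn : U.Normal]
    (hU : IsOpen (U : Set (GaloisGroupUnramifiedOutside K (↑S : Set (HeightOneSpectrum (𝓞 K)))))) [U.FiniteIndex]
    (hUA : ∀ u : GaloisGroupUnramifiedOutside K (↑S : Set (HeightOneSpectrum (𝓞 K))), u ∈ U →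
      ∀ a : A.obj.V, A.obj.ρ u a = a)
    (P1mono : ∀ y : Ext (triv (k := ℤ) (Γ := ↥U) ℤ) ((resD ℤ U).obj (truncIdeleBarD K S)) 1, y = 0)
    (P1epi : ∀ (w : OverS K S) (z : Ext (triv (k := ℤ) (Γ := ↥(U.comap (decompMapPlaceS K S w.1))) ℤ)
      ((resD ℤ (U.comap (decompMapPlaceS K S w.1))).obj (unitsD (Place.Completion w.1))) 1), z = 0)
    (P2mono : ∀ y : Ext (triv (k := ℤ) (Γ := ↥U) ℤ) ((resD ℤ U).obj (truncIdeleBarD K S)) 2,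
      (∀ (w : OverS K S) (t : DoubleCosets (decompMapPlaceS K S w.1) U),
        (y.mapExactFunctor (resDHom ℤ (conjHom (decompMapPlaceS K S w.1) U (dcRep (decompMapPlaceS K S w.1) U t))
          (continuous_conjHom (decompMapPlaceS K S w.1) (continuous_decompMapPlaceS K S w.1) U
            (dcRep (decompMapPlaceS K S w.1) U t)))).comp
          (Ext.mk₀ (conjCoeff (decompMapPlaceS K S w.1) (continuous_decompMapPlaceS K S w.1) U
            (truncIdeleBarD K S) (unitsD (Place.Completion w.1)) (locQ K S w) (dcRep (decompMapPlaceS K S w.1) U t)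
            (k := ℤ))) (add_zero 2) = 0) → y = 0)
    (P0epi : Function.Surjective (idLocMap K S ((coindD ℤ U hU).obj (triv (k := ℤ) (Γ := ↥U) ℤ)) 0))
    (Hmono : ∀ N : DiscreteRepCat ℤ (GaloisGroupUnramifiedOutside K (↑S : Set (HeightOneSpectrum (𝓞 K)))),
      Function.Injective (idLocMap K S N 0)) :
    Function.Injective (idLocMap K S A 2) := by
  haveI hVf : ∀ w : OverS K S, (U.comap (decompMapPlaceS K S w.1)).FiniteIndex :=
    fun w => finiteIndex_comap (decompMapPlaceS K S w.1) U
  refine locMap_injective_two_of_permutation U hU (locFun K S) (locQ K S) A hUA ?_ Hmono ?_ ?_ ?_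
  · -- [P0-epi] for all `m` from `m = 1`
    exact fun m => locMap_surjective_coindD_fin U hU (locFun K S) (locQ K S) 0 P0epi m
  · -- [P1-mono]: the source `Ext¹(Coind_U(ℤ^m), Ī_S)` vanishes (Shapiro + `H¹(U, Ī_S) = 0`)
    intro m
    refine locMap_injective_coindD_fin U hU (locFun K S) (locQ K S) 1 (fun x x' _ => ?_) m
    have h0 : ∀ z : Ext ((coindD ℤ U hU).obj (triv (k := ℤ) (Γ := ↥U) ℤ)) (truncIdeleBarD K S) 1, z = 0 :=
      fun z => (extCoindResAddEquiv U hU _ _ 1).injective ((P1mono _).trans (map_zero _).symm)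
    rw [h0 x, h0 x']
  · -- [P1-epi]: the target vanishes (local `H¹ = 0`, Mackey, Shapiro, additivity)
    intro m y
    refine ⟨0, ?_⟩
    rw [map_zero]
    funext w
    exact (ext_one_locFun_coindD_eq_zero U hU w (P1epi w) m (y w)).symm
  · -- [P2-mono]: `m = 1` by the component formula and the raw input, then all `m`
    intro m
    refine locMap_injective_coindD_fin U hU (locFun K S) (locQ K S) 2 ?_ m
    rw [injective_iff_map_eq_zero]
    intro x hx
    have hSh : ExtAdjunction.extAdjunctionMap (coindResAdj U hU) (triv (k := ℤ) (Γ := ↥U) ℤ)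
        (truncIdeleBarD K S) 2 x = 0 := by
      refine P2mono _ fun w t => ?_
      rw [← locComponent_eq (decompMapPlaceS K S w.1) (continuous_decompMapPlaceS K S w.1) U hU ℤ
        (truncIdeleBarD K S) (unitsD (Place.Completion w.1)) (locQ K S w) 2 t x]
      exact locComponent_eq_zero_of_eq_zero U hU w ℤ 2 x (congrFun hx w) t
    exact (injective_iff_map_eq_zero _).1
      (ExtAdjunction.extAdjunctionMap_bijective (coindResAdj U hU) (triv (k := ℤ) (Γ := ↥U) ℤ)
        (truncIdeleBarD K S) 2).1 x hSh

end IdeleReadout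

end Literature.NumberTheory.GaloisRepresentations

end
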